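/-
Copyright (c) 2026. All rights reserved.
Released under Apache 2.0 license as described in the file LICENSE.
Authors: HodgeCM publication cell (pub-hodgecm), GR lane, seat GR-2 (`pub-hodgecm-own-hyp34`).
-/
import Literature.NumberTheory.GelbartRogawski1991.Prop311PrintedFrame
import HarnessLib

/-!
# [GelbartRogawski1991, §3.1, Prop. 3.1.1]: the PRINTED `G(𝐀)` in an `E`-frame —
# `Prop311.adelicUnitary F E V Φ ≃* UnitaryGroup.adelic F E σ N J` (the CARRIER JUNCTION, unitary side)

Topic `NumberTheory/GelbartRogawski1991`; namespace `Literature.NumberTheory.GelbartRogawski1991.Prop311`.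
Definitions and proved lemmas only; nothing of [GelbartRogawski1991] is asserted; `Prop311AsPrinted` is untouched.

[GelbartRogawski1991, §3.1 p. 454 L37–38, Prop. 3.1.1 p. 455 L1–2]: "*Let `(V, Φ)` be a skew Hermitian space, where `V`
is an `n`-dimensional vector space over `E`. In this §, let `G` denote the unitary group attached to `(V, Φ)`.*" …
"*The covering `π` splits over `G(𝐀)`.*"  The statement-exact typing renders `G(𝐀)` frame-free (rendering R5 of
`Prop311AsPrinted`): `Prop311.adelicUnitary F E V Φ` = the `𝐀`-linear automorphisms of `W_𝐀 = 𝐀 ⊗_F V` commuting with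
the scalars of `E` and preserving `Φ_𝐀 = Φ ⊗ 𝐀` (values in `𝐀 ⊗_F E`).  The tree's unitary groups over number fields
(`Automorphic/UnitaryGroupAutomorphicRep`: `UnitaryGroup.adelic F E σ N J = {g ∈ GL_N(𝔸_E) | ᵗ(σ g) J g = J}`, over which
`GRConstruction.gru_shape`, the dual-pair carriers and `adelicToSymplectic` are built) are MATRIX groups over
`𝔸_E = AdeleRing (𝓞 E) E`.  This file identifies the two, for an `E`-basis `b` of `V` (`N := n`) and quadratic coordinates
`E = F ⊕ F δ` (`σ δ = -δ ≠ 0`, `δ² = d`; the frame file `Prop311PrintedFrame`):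

* §1 **`tensorToAdele : 𝐀 ⊗_F E →+ 𝔸_E`**, `t ⊗ e ↦ (t ⊗ 1)(e ⊗ 1)`, with left inverse `adeleToTensor`
  (`y ↦ re y ⊗ 1 + im y ⊗ δ`), hence INJECTIVE — the values of `Φ_𝐀` read in `𝔸_E`;
* §2 the GRAM MATRIX `gramMatrix b Φ = (Φ(b_j, b_i))_{ij} ∈ M_N(E)` and the coordinate expansion
  `Φ v v' = Σᵢⱼ [v]ᵢ Φ(bᵢ, bⱼ) σ[v']ⱼ` (`apply_eq_sum_repr`, from the printed axioms `Φ(e x, y) = e Φ(x, y)`,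
  `Φ(x, e y) = Φ(x, y) σ(e)`), the hermitian pairing on basis vectors and the converse of `hermForm_mulVec`
  (`matrix_eq_of_forall_hermForm_eq`: a matrix preserving `h_H` satisfies `ᵗ(σ g) H g = H`);
* §3 the `E`-frame coordinates **`frameCoord b : W_𝐀 ≃+ 𝔸_Eᴺ`** (`= reIm⁻¹ ∘ adelicFrame b`; `𝐀`-semilinear,
  `frameCoord (g w) = [g]_b · frameCoord w` for `g ∈ GL_{𝐀 ⊗ E}(W_𝐀)`), and the DICTIONARY
  **`tensorToAdele (Φ_𝐀 x y) = h_{J ⊗ 1}(frameCoord y, frameCoord x)`** (`tensorToAdele_adelicHermForm`),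
  `h_H(X, Y) = ᵗ(σ X) H Y` the tree's `hermForm`, `J = gramMatrix b Φ`;
* §4 **`mem_adelicUnitary_iff_frameGL_mem`**: `g ∈ G(𝐀)` (print) **iff** `[g]_b ∈ UnitaryGroup.adelic F E σ N J` (tree),
  and the group isomorphism **`frameUnitary b : Prop311.adelicUnitary F E V Φ ≃* UnitaryGroup.adelic F E σ N (gramMatrix b Φ)`**
  with `adelicFrame b (g w) = resAut (frameUnitary b g) (adelicFrame b w)`;
* §5 CONTINUITY of `(frameUnitary b)⁻¹` (tree topology → printed topology of pointwise convergence on `W_𝐀`,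
  `continuous_frameUnitary_symm`) and of the matrix ENTRIES of `frameUnitary b g` in `g` (`continuous_coe_frameUnitary`);
  the full homeomorphism needs the continuity of `g ↦ [g]_b⁻¹`, i.e. `J` invertible (`Φ` non-degenerate), and is left
  to the sequel together with the rational points `G(F)`.

With `CompatibleSplittingInvariance` (transport of `SplittingDatum.CompatibleSplitting` along homomorphisms of the three
carriers) this is the `GA`-leg of the comparison between `GRConstruction.gru_shape` (record, matrix carriers) and
[GelbartRogawski1991, Prop. 3.1.1] AS PRINTED.

## References
* [GelbartRogawski1991] S. Gelbart, J. Rogawski, Invent. Math. 105 (1991) 445–472, §3.1 p. 454 L37–42, Prop. 3.1.1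
  p. 455 L1–2.
* [Mok2014] C. P. Mok, Mem. AMS 235 (2015), §1 Notation p. 5 (unitary groups `U(J)` over a quadratic extension as matrix
  groups inside `Res GL_N`).
* [Lang2002] S. Lang, *Algebra*, GTM 211 (2002), Ch. XIII §1, Ch. XV §1 (matrices of sesquilinear forms) — for §1–§2.
-/

set_option autoImplicit false

noncomputable section

open NumberField
open scoped TensorProduct Matrix
open Literature.NumberTheory.Automorphic
open Literature.NumberTheory.Automorphic.UnitaryGroup

namespace Literature.NumberTheory.GelbartRogawski1991

namespace Prop311

open QuadraticCoordinates

variable (F : Type) [Field F] [NumberField F]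
variable (E : Type) [Field E] [NumberField E] [Algebra F E] [Algebra.IsQuadraticExtension F E]
variable (σ : E ≃ₐ[F] E) {δ : E} (hσδ : σ δ = -δ) (hδ : δ ≠ 0) {d : F} (hd : δ * δ = algebraMap F E d)
variable (V : Type) [AddCommGroup V] [Module F V] [Module E V] [IsScalarTower F E V]
variable {n : ℕ} (b : Module.Basis (Fin n) E V)
variable (Φ : V →ₗ[F] V →ₗ[F] E)

/-! ## §1. `𝐀 ⊗_F E → 𝔸_E` -/

section TensorToAdele

omit [Algebra.IsQuadraticExtension F E] in
/-- **`𝐀 ⊗_F E →+ 𝔸_E`, `t ⊗ e ↦ (t ⊗ 1) · (e ⊗ 1)`**: the values `𝐀 ⊗_F E = 𝐀_E` of print's `Φ_𝐀` (p. 454 L37–38: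
`Φ` has values in `E`) read in the adele ring of `E` of the tree's carriers. [cite: GelbartRogawski1991, §3.1 p. 454 L37–38] -/
def tensorToAdele : AdeleRing (𝓞 F) F ⊗[F] E →+ AdeleRing (𝓞 E) E :=
  TensorProduct.liftAddHom
    (((AddMonoidHom.mul : AdeleRing (𝓞 E) E →+ AdeleRing (𝓞 E) E →+ AdeleRing (𝓞 E) E).comp
        (AdeleRing.baseChange F E).toAddMonoidHom).compl₂ (algebraMap E (AdeleRing (𝓞 E) E)).toAddMonoidHom)
    fun r t e => by
      show AdeleRing.baseChange F E (r • t) * algebraMap E (AdeleRing (𝓞 E) E) e =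
        AdeleRing.baseChange F E t * algebraMap E (AdeleRing (𝓞 E) E) (r • e)
      rw [Algebra.smul_def, Algebra.smul_def, map_mul, map_mul, AdeleRing.baseChange_algebraMap]
      ring

omit [Algebra.IsQuadraticExtension F E] in
/-- formula on pure tensors. [cite: GelbartRogawski1991, §3.1 p. 454 L37–38] -/
@[simp] theorem tensorToAdele_tmul (t : AdeleRing (𝓞 F) F) (e : E) :
    tensorToAdele F E (t ⊗ₜ e) = AdeleRing.baseChange F E t * algebraMap E (AdeleRing (𝓞 E) E) e :=
  rfl

/-- the inverse direction `𝔸_E → 𝐀 ⊗_F E`, `y ↦ re y ⊗ 1 + im y ⊗ δ` (quadratic coordinates `𝔸_E = 𝐀 ⊕ 𝐀 δ`).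
[cite: GelbartRogawski1991, §3.1 p. 454 L37–38] -/
def adeleToTensor : AdeleRing (𝓞 E) E →+ AdeleRing (𝓞 F) F ⊗[F] E where
  toFun y := re (quadraticAdeleEquiv F E σ hσδ hδ).toAddEquiv y ⊗ₜ (1 : E) +
    im (quadraticAdeleEquiv F E σ hσδ hδ).toAddEquiv y ⊗ₜ δ
  map_zero' := by simp only [map_zero, TensorProduct.zero_tmul, add_zero]
  map_add' y y' := by
    simp only [map_add, TensorProduct.add_tmul]
    abel

include hd in
/-- `adeleToTensor ∘ tensorToAdele = id`. [cite: GelbartRogawski1991, §3.1 p. 454 L37–38] -/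
theorem adeleToTensor_tensorToAdele (z : AdeleRing (𝓞 F) F ⊗[F] E) :
    adeleToTensor F E σ hσδ hδ (tensorToAdele F E z) = z := by
  induction z using TensorProduct.induction_on with
  | zero => simp only [map_zero]
  | tmul t e =>
    rw [tensorToAdele_tmul]
    show re (quadraticAdeleEquiv F E σ hσδ hδ).toAddEquiv _ ⊗ₜ (1 : E) +
        im (quadraticAdeleEquiv F E σ hσδ hδ).toAddEquiv _ ⊗ₜ δ = t ⊗ₜ e
    rw [(isQuadraticCoordinates_adele E σ hσδ hδ hd).re_map_mul, (isQuadraticCoordinates_adele E σ hσδ hδ hd).im_map_mul,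
      adele_re_algebraMap F E σ hσδ hδ hd, adele_im_algebraMap F E σ hσδ hδ hd, mul_comm t, ← Algebra.smul_def,
      TensorProduct.smul_tmul, mul_comm t, ← Algebra.smul_def, TensorProduct.smul_tmul, ← TensorProduct.tmul_add,
      Algebra.smul_def, Algebra.smul_def, mul_one, (isQuadraticCoordinates_rat E σ hσδ hδ hd).re_add_im]
  | add x y hx hy => rw [map_add, map_add, hx, hy]

include σ hσδ hδ hd in
/-- **`𝐀 ⊗_F E → 𝔸_E` is injective** (it has the left inverse `adeleToTensor`; the quadratic coordinates `σ, δ, d` are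
used in the proof only). [cite: GelbartRogawski1991, §3.1 p. 454 L37–38] -/
theorem tensorToAdele_injective : Function.Injective (tensorToAdele F E) :=
  Function.LeftInverse.injective (adeleToTensor_tensorToAdele F E σ hσδ hδ hd)

end TensorToAdele

/-! ## §2. The Gram matrix of `Φ` in the basis `b`; hermitian pairings determine their matrix -/

section Gram

omit [NumberField F] [NumberField E] [Algebra.IsQuadraticExtension F E] [IsScalarTower F E V] in
/-- **the Gram matrix `J = (Φ(b_j, b_i))_{ij}` of `Φ` in the `E`-basis `b`** (transposed indexing, so that
`Φ(v, v') = h_J([v'], [v])` for the tree's `hermForm σ J X Y = ᵗ(σ X) J Y`). [cite: GelbartRogawski1991, §3.1 p. 454 L37–38] -/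
def gramMatrix : Matrix (Fin n) (Fin n) E := Matrix.of fun i j => Φ (b j) (b i)

omit [NumberField F] [NumberField E] [Algebra.IsQuadraticExtension F E] [IsScalarTower F E V] in
/-- entries of the Gram matrix. [cite: GelbartRogawski1991, §3.1 p. 454 L37–38] -/
@[simp] theorem gramMatrix_apply (i j : Fin n) : gramMatrix F E V b Φ i j = Φ (b j) (b i) := rfl

omit [NumberField F] [NumberField E] [Algebra.IsQuadraticExtension F E] [IsScalarTower F E V] in
/-- **coordinate expansion of a sesquilinear `Φ`**: `Φ v v' = Σᵢⱼ [v]ᵢ Φ(bᵢ, bⱼ) σ([v']ⱼ)` from the printed axioms "`E`-linear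
in the first variable, `σ`-semilinear in the second". [cite: GelbartRogawski1991, §3.1 p. 454 L37–38] -/
theorem apply_eq_sum_repr (hΦ₁ : ∀ (e : E) (x y : V), Φ (e • x) y = e * Φ x y)
    (hΦ₂ : ∀ (e : E) (x y : V), Φ x (e • y) = Φ x y * σ e) (v v' : V) :
    Φ v v' = ∑ i, ∑ j, b.repr v i * Φ (b i) (b j) * σ (b.repr v' j) := by
  conv_lhs => rw [← b.sum_repr v, ← b.sum_repr v']
  simp only [map_sum, LinearMap.sum_apply, hΦ₁, hΦ₂, mul_assoc]
  exact Finset.sum_comm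

variable {S : Type*} [CommRing S] {m : Type*} [Fintype m] [DecidableEq m]

/-- the hermitian pairing on basis vectors: `h_H(eᵢ, eⱼ) = Hᵢⱼ`. [cite: Mok2014, §1 Notation p. 5] -/
theorem hermForm_single_single (τ : S →+* S) (H : Matrix m m S) (i j : m) :
    hermForm τ H (Pi.single i 1) (Pi.single j 1) = H i j := by
  have h1 : (⇑τ ∘ (Pi.single i (1 : S) : m → S)) = Pi.single i 1 := by
    funext k
    by_cases hk : k = i
    · subst hk; simp only [Function.comp_apply, Pi.single_eq_same, map_one]
    · simp only [Function.comp_apply, Pi.single_eq_of_ne hk, map_zero]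
  rw [hermForm_apply, h1, single_dotProduct, one_mul, Matrix.mulVec_single_one]
  rfl

omit [DecidableEq m] in
/-- `h_H(g x, g y) = h_{ᵗ(τ g) H g}(x, y)`: transporting the matrix instead of the vectors. [cite: Mok2014, §1 Notation p. 5] -/
theorem hermForm_mulVec_mulVec_eq (τ : S →+* S) (H g : Matrix m m S) (x y : m → S) :
    hermForm τ H (g *ᵥ x) (g *ᵥ y) = hermForm τ ((g.map τ)ᵀ * H * g) x y := by
  have h1 : (⇑τ ∘ (g *ᵥ x)) = g.map τ *ᵥ (⇑τ ∘ x) := funext fun i => RingHom.map_mulVec τ g x i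
  rw [hermForm_apply, hermForm_apply, h1, ← Matrix.mulVec_mulVec, ← Matrix.mulVec_mulVec,
    Matrix.dotProduct_mulVec (v := ⇑τ ∘ x) (A := (g.map τ)ᵀ), Matrix.vecMul_transpose]

/-- **converse of `hermForm_mulVec`**: a matrix `g` preserving the pairing `h_H` satisfies `ᵗ(τ g) H g = H`.
[cite: Mok2014, §1 Notation p. 5] -/
theorem matrix_eq_of_forall_hermForm_eq (τ : S →+* S) (H g : Matrix m m S)
    (hg : ∀ x y : m → S, hermForm τ H (g *ᵥ x) (g *ᵥ y) = hermForm τ H x y) :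
    (g.map τ)ᵀ * H * g = H := by
  ext i j
  rw [← hermForm_single_single τ ((g.map τ)ᵀ * H * g) i j, ← hermForm_mulVec_mulVec_eq, hg, hermForm_single_single]

end Gram

/-! ## §3. The `E`-frame coordinates `W_𝐀 ≃+ 𝔸_Eᴺ` and the dictionary for `Φ_𝐀` -/

section Coord

/-- **`frameCoord b : W_𝐀 ≃+ 𝔸_Eᴺ`**, `= reIm⁻¹ ∘ adelicFrame b`: the coordinate vector over `𝔸_E` in the frame `b ⊗ 1`.
[cite: GelbartRogawski1991, §3.1 p. 454 L37–42] -/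
def frameCoord : AdelicSpace F V ≃+ (Fin n → AdeleRing (𝓞 E) E) :=
  (adelicFrame F E σ hσδ hδ hd V b).toAddEquiv.trans (reIm (quadraticAdeleEquiv F E σ hσδ hδ).toAddEquiv (Fin n)).symm

/-- `reIm (frameCoord b w) = adelicFrame b w`. [cite: GelbartRogawski1991, §3.1 p. 454 L41–42] -/
@[simp] theorem reIm_frameCoord (w : AdelicSpace F V) :
    reIm (quadraticAdeleEquiv F E σ hσδ hδ).toAddEquiv (Fin n) (frameCoord F E σ hσδ hδ hd V b w) =
      adelicFrame F E σ hσδ hδ hd V b w :=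
  (reIm (quadraticAdeleEquiv F E σ hσδ hδ).toAddEquiv (Fin n)).apply_symm_apply _

/-- `(frameCoord b)⁻¹ X = (adelicFrame b)⁻¹ (reIm X)`. [cite: GelbartRogawski1991, §3.1 p. 454 L41–42] -/
theorem frameCoord_symm_apply (X : Fin n → AdeleRing (𝓞 E) E) :
    (frameCoord F E σ hσδ hδ hd V b).symm X =
      (adelicFrame F E σ hσδ hδ hd V b).symm (reIm (quadraticAdeleEquiv F E σ hσδ hδ).toAddEquiv (Fin n) X) :=
  rfl

/-- on pure tensors `frameCoord b (t ⊗ v) = frameCoordE b t v = ((t ⊗ 1)([v]ᵢ ⊗ 1))ᵢ`.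
[cite: GelbartRogawski1991, §3.1 p. 454 L41–42] -/
@[simp] theorem frameCoord_tmul (t : AdeleRing (𝓞 F) F) (v : V) :
    frameCoord F E σ hσδ hδ hd V b (t ⊗ₜ v) = frameCoordE F E V b t v := by
  apply (reIm (quadraticAdeleEquiv F E σ hσδ hδ).toAddEquiv (Fin n)).injective
  rw [reIm_frameCoord, adelicFrame_tmul]

/-- `frameCoord b` is `𝐀`-semilinear along `𝐀 → 𝔸_E`: `frameCoord (t • w) = (t ⊗ 1) • frameCoord w`.
[cite: GelbartRogawski1991, §3.1 p. 454 L41–42] -/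
theorem frameCoord_smul (t : AdeleRing (𝓞 F) F) (w : AdelicSpace F V) :
    frameCoord F E σ hσδ hδ hd V b (t • w) = AdeleRing.baseChange F E t • frameCoord F E σ hσδ hδ hd V b w := by
  apply (reIm (quadraticAdeleEquiv F E σ hσδ hδ).toAddEquiv (Fin n)).injective
  rw [reIm_frameCoord, map_smul, (isQuadraticCoordinates_adele E σ hσδ hδ hd).reIm_map_smul, reIm_frameCoord]

/-- **`frameCoord b (g w) = [g]_b · frameCoord b w`** for `g ∈ GL_{𝐀 ⊗ E}(W_𝐀)`.
[cite: GelbartRogawski1991, §3.1 p. 454 L37–42] -/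
theorem frameCoord_apply_adelicGLE (g : adelicGLE F E V) (w : AdelicSpace F V) :
    frameCoord F E σ hσδ hδ hd V b ((g : AdelicSpace F V ≃ₗ[AdeleRing (𝓞 F) F] AdelicSpace F V) w) =
      ((frameGL F E σ hσδ hδ hd V b g : GL (Fin n) (AdeleRing (𝓞 E) E)) : Matrix (Fin n) (Fin n) (AdeleRing (𝓞 E) E)) *ᵥ
        frameCoord F E σ hσδ hδ hd V b w := by
  apply (reIm (quadraticAdeleEquiv F E σ hσδ hδ).toAddEquiv (Fin n)).injective
  rw [reIm_frameCoord, adelicFrame_apply_eq_resAut_frameGL, ← (isQuadraticCoordinates_adele E σ hσδ hδ hd).resAut_reIm,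
    reIm_frameCoord]

omit [Algebra.IsQuadraticExtension F E] [Module F V] [IsScalarTower F E V] in
/-- `σ_𝔸 ∘ frameCoordE b t v = ((t ⊗ 1)(σ[v]ᵢ ⊗ 1))ᵢ`: the adelic conjugation fixes `𝐀 ⊗ 1` and is `σ` on `E ⊗ 1`.
[cite: GelbartRogawski1991, §1.1 p. 449 L26] -/
theorem conjAdele_comp_frameCoordE (t : AdeleRing (𝓞 F) F) (v : V) :
    ⇑(conjAdele F E σ) ∘ frameCoordE F E V b t v = fun i =>
      AdeleRing.baseChange F E t * algebraMap E (AdeleRing (𝓞 E) E) (σ (b.repr v i)) := by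
  funext i
  rw [Function.comp_apply, frameCoordE_apply, map_mul, conjAdele_apply, conjAdele_apply, AdeleRing.smul_baseChange,
    AdeleRing.smul_algebraMap]

omit [NumberField E] [Algebra.IsQuadraticExtension F E] in
/-- additivity of the tree's `hermForm` in the first variable. [cite: Mok2014, §1 Notation p. 5] -/
theorem hermForm_add_left {S : Type*} [CommRing S] {m : Type*} [Fintype m] (τ : S →+* S) (H : Matrix m m S)
    (x x' y : m → S) : hermForm τ H (x + x') y = hermForm τ H x y + hermForm τ H x' y := by
  rw [hermForm_apply, hermForm_apply, hermForm_apply, ← add_dotProduct]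
  congr 1
  funext i
  simp only [Function.comp_apply, Pi.add_apply, map_add]

omit [NumberField E] [Algebra.IsQuadraticExtension F E] in
/-- additivity of the tree's `hermForm` in the second variable. [cite: Mok2014, §1 Notation p. 5] -/
theorem hermForm_add_right {S : Type*} [CommRing S] {m : Type*} [Fintype m] (τ : S →+* S) (H : Matrix m m S)
    (x y y' : m → S) : hermForm τ H x (y + y') = hermForm τ H x y + hermForm τ H x y' := by
  rw [hermForm_apply, hermForm_apply, hermForm_apply, Matrix.mulVec_add, dotProduct_add]

omit [NumberField E] [Algebra.IsQuadraticExtension F E] in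
/-- `hermForm` vanishes on a zero first argument. [cite: Mok2014, §1 Notation p. 5] -/
theorem hermForm_zero_left {S : Type*} [CommRing S] {m : Type*} [Fintype m] (τ : S →+* S) (H : Matrix m m S)
    (y : m → S) : hermForm τ H 0 y = 0 := by
  have h0 : (⇑τ ∘ (0 : m → S)) = 0 := funext fun _ => map_zero τ
  rw [hermForm_apply, h0, zero_dotProduct]

omit [NumberField E] [Algebra.IsQuadraticExtension F E] in
/-- `hermForm` vanishes on a zero second argument. [cite: Mok2014, §1 Notation p. 5] -/
theorem hermForm_zero_right {S : Type*} [CommRing S] {m : Type*} [Fintype m] (τ : S →+* S) (H : Matrix m m S)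
    (x : m → S) : hermForm τ H x 0 = 0 := by
  rw [hermForm_apply, Matrix.mulVec_zero, dotProduct_zero]

/-- **the dictionary**: `tensorToAdele (Φ_𝐀 x y) = h_{J ⊗ 1}(frameCoord y, frameCoord x)` — print's `Φ_𝐀 = Φ ⊗ 𝐀` on
`W_𝐀`, read in `𝔸_E`, is the tree's hermitian pairing of the Gram matrix `J = gramMatrix b Φ` on the frame coordinates.
[cite: GelbartRogawski1991, §3.1 p. 454 L37–42] -/
theorem tensorToAdele_adelicHermForm (hΦ₁ : ∀ (e : E) (x y : V), Φ (e • x) y = e * Φ x y)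
    (hΦ₂ : ∀ (e : E) (x y : V), Φ x (e • y) = Φ x y * σ e) (x y : AdelicSpace F V) :
    tensorToAdele F E (adelicHermForm F E V Φ x y) =
      hermForm (conjAdele F E σ) ((gramMatrix F E V b Φ).map (algebraMap E (AdeleRing (𝓞 E) E)))
        (frameCoord F E σ hσδ hδ hd V b y) (frameCoord F E σ hσδ hδ hd V b x) := by
  induction x using TensorProduct.induction_on with
  | zero => rw [map_zero, LinearMap.zero_apply, map_zero, map_zero, hermForm_zero_right]
  | tmul t v =>
    induction y using TensorProduct.induction_on with
    | zero => rw [map_zero, map_zero, map_zero, hermForm_zero_left]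
    | tmul t' v' =>
      rw [adelicHermForm, LinearMap.BilinMap.baseChange_tmul, tensorToAdele_tmul,
        apply_eq_sum_repr F E σ V b Φ hΦ₁ hΦ₂, frameCoord_tmul, frameCoord_tmul, hermForm_apply,
        conjAdele_comp_frameCoordE]
      simp only [dotProduct, Matrix.mulVec, frameCoordE_apply, Matrix.map_apply, gramMatrix_apply, map_sum, map_mul,
        Finset.mul_sum]
      rw [Finset.sum_comm]
      refine Finset.sum_congr rfl fun i _ => Finset.sum_congr rfl fun j _ => ?_
      ring
    | add y₁ y₂ h₁ h₂ => rw [map_add, map_add, map_add, hermForm_add_left, h₁, h₂]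
  | add x₁ x₂ h₁ h₂ => rw [map_add, LinearMap.add_apply, map_add, map_add, hermForm_add_right, h₁, h₂]

end Coord

/-! ## §4. `G(𝐀)` (print) `≃*` `U(J)(𝔸_F)` (tree) -/

section Unitary

/-- **`g ∈ G(𝐀)` iff `[g]_b ∈ U(J)(𝔸_F)`** for `g ∈ GL_{𝐀 ⊗ E}(W_𝐀)` and `J = gramMatrix b Φ`: preserving `Φ_𝐀` on `W_𝐀` is,
in the frame, `ᵗ(σ_𝔸 [g]) (J ⊗ 1) [g] = J ⊗ 1`. [cite: GelbartRogawski1991, §3.1 p. 454 L37–38; Prop. 3.1.1 p. 455 L1] -/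
theorem mem_adelicUnitary_iff_frameGL_mem (hΦ₁ : ∀ (e : E) (x y : V), Φ (e • x) y = e * Φ x y)
    (hΦ₂ : ∀ (e : E) (x y : V), Φ x (e • y) = Φ x y * σ e) (g : adelicGLE F E V) :
    (g : AdelicSpace F V ≃ₗ[AdeleRing (𝓞 F) F] AdelicSpace F V) ∈ adelicUnitary F E V Φ ↔
      frameGL F E σ hσδ hδ hd V b g ∈ UnitaryGroup.adelic F E σ n (gramMatrix F E V b Φ) := by
  rw [mem_adelicUnitary, UnitaryGroup.adelic, mem_unitaryGroupOfForm_iff, UnitaryGroup.adelicForm]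
  constructor
  · rintro ⟨-, hΦg⟩
    refine matrix_eq_of_forall_hermForm_eq _ _ _ fun X Y => ?_
    obtain ⟨y, rfl⟩ := (frameCoord F E σ hσδ hδ hd V b).surjective X
    obtain ⟨x, rfl⟩ := (frameCoord F E σ hσδ hδ hd V b).surjective Y
    rw [← frameCoord_apply_adelicGLE, ← frameCoord_apply_adelicGLE,
      ← tensorToAdele_adelicHermForm F E σ hσδ hδ hd V b Φ hΦ₁ hΦ₂,
      ← tensorToAdele_adelicHermForm F E σ hσδ hδ hd V b Φ hΦ₁ hΦ₂, hΦg]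
  · intro hG
    refine ⟨g.2, fun x y => tensorToAdele_injective F E σ hσδ hδ hd ?_⟩
    rw [tensorToAdele_adelicHermForm F E σ hσδ hδ hd V b Φ hΦ₁ hΦ₂,
      tensorToAdele_adelicHermForm F E σ hσδ hδ hd V b Φ hΦ₁ hΦ₂, frameCoord_apply_adelicGLE,
      frameCoord_apply_adelicGLE, hermForm_mulVec _ hG]

/-- **`frameUnitary b : G(𝐀) ≃* U(J)(𝔸_F)`**, `g ↦ [g]_b` — the printed adelic unitary group of `(V, Φ)` IS the tree's
matrix group `UnitaryGroup.adelic F E σ N (gramMatrix b Φ) ≤ GL_N(𝔸_E)` (restriction of `frameGL b`).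
[cite: GelbartRogawski1991, §3.1 p. 454 L37–38; Prop. 3.1.1 p. 455 L1] -/
def frameUnitary (hΦ₁ : ∀ (e : E) (x y : V), Φ (e • x) y = e * Φ x y)
    (hΦ₂ : ∀ (e : E) (x y : V), Φ x (e • y) = Φ x y * σ e) :
    adelicUnitary F E V Φ ≃* UnitaryGroup.adelic F E σ n (gramMatrix F E V b Φ) where
  toFun g := ⟨frameGL F E σ hσδ hδ hd V b ⟨g, adelicUnitary_le_adelicGLE F E V Φ g.2⟩,
    (mem_adelicUnitary_iff_frameGL_mem F E σ hσδ hδ hd V b Φ hΦ₁ hΦ₂ _).1 g.2⟩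
  invFun G := ⟨(frameGL F E σ hσδ hδ hd V b).symm G,
    (mem_adelicUnitary_iff_frameGL_mem F E σ hσδ hδ hd V b Φ hΦ₁ hΦ₂ _).2
      (by rw [MulEquiv.apply_symm_apply]; exact G.2)⟩
  left_inv g := Subtype.ext (by
    simp only [MulEquiv.symm_apply_apply])
  right_inv G := Subtype.ext (by
    simp only [Subtype.coe_eta, MulEquiv.apply_symm_apply])
  map_mul' g g' := Subtype.ext (by
    simp only [Subgroup.coe_mul, ← map_mul]
    rfl)

/-- `frameUnitary b g` is `frameGL b g` on underlying invertible matrices. [cite: GelbartRogawski1991, §3.1 p. 454 L37–38] -/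
@[simp] theorem coe_frameUnitary (hΦ₁ : ∀ (e : E) (x y : V), Φ (e • x) y = e * Φ x y)
    (hΦ₂ : ∀ (e : E) (x y : V), Φ x (e • y) = Φ x y * σ e) (g : adelicUnitary F E V Φ) :
    ((frameUnitary F E σ hσδ hδ hd V b Φ hΦ₁ hΦ₂ g : UnitaryGroup.adelic F E σ n (gramMatrix F E V b Φ)) :
        GL (Fin n) (AdeleRing (𝓞 E) E)) =
      frameGL F E σ hσδ hδ hd V b ⟨g, adelicUnitary_le_adelicGLE F E V Φ g.2⟩ :=
  rfl

/-- **the frame intertwines `g ∈ G(𝐀)` with its matrix**: `adelicFrame b (g w) = resAut (frameUnitary b g) (adelicFrame b w)`.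
[cite: GelbartRogawski1991, §3.1 p. 454 L37–42] -/
theorem adelicFrame_apply_eq_resAut_frameUnitary (hΦ₁ : ∀ (e : E) (x y : V), Φ (e • x) y = e * Φ x y)
    (hΦ₂ : ∀ (e : E) (x y : V), Φ x (e • y) = Φ x y * σ e) (g : adelicUnitary F E V Φ) (w : AdelicSpace F V) :
    adelicFrame F E σ hσδ hδ hd V b ((g : AdelicSpace F V ≃ₗ[AdeleRing (𝓞 F) F] AdelicSpace F V) w) =
      (isQuadraticCoordinates_adele E σ hσδ hδ hd).resAut (Fin n)
        ((frameUnitary F E σ hσδ hδ hd V b Φ hΦ₁ hΦ₂ g : UnitaryGroup.adelic F E σ n (gramMatrix F E V b Φ)) :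
          GL (Fin n) (AdeleRing (𝓞 E) E))
        (adelicFrame F E σ hσδ hδ hd V b w) :=
  adelicFrame_apply_eq_resAut_frameGL F E σ hσδ hδ hd V b ⟨g, adelicUnitary_le_adelicGLE F E V Φ g.2⟩ w

/-- … and with coordinates in `𝔸_Eᴺ`: `frameCoord b (g w) = (frameUnitary b g) · frameCoord b w`.
[cite: GelbartRogawski1991, §3.1 p. 454 L37–42] -/
theorem frameCoord_apply_adelicUnitary (hΦ₁ : ∀ (e : E) (x y : V), Φ (e • x) y = e * Φ x y)
    (hΦ₂ : ∀ (e : E) (x y : V), Φ x (e • y) = Φ x y * σ e) (g : adelicUnitary F E V Φ) (w : AdelicSpace F V) :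
    frameCoord F E σ hσδ hδ hd V b ((g : AdelicSpace F V ≃ₗ[AdeleRing (𝓞 F) F] AdelicSpace F V) w) =
      (((frameUnitary F E σ hσδ hδ hd V b Φ hΦ₁ hΦ₂ g : UnitaryGroup.adelic F E σ n (gramMatrix F E V b Φ)) :
          GL (Fin n) (AdeleRing (𝓞 E) E)) : Matrix (Fin n) (Fin n) (AdeleRing (𝓞 E) E)) *ᵥ
        frameCoord F E σ hσδ hδ hd V b w :=
  frameCoord_apply_adelicGLE F E σ hσδ hδ hd V b ⟨g, adelicUnitary_le_adelicGLE F E V Φ g.2⟩ w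

/-- the inverse on elements: `(frameUnitary b)⁻¹ G` acts on `W_𝐀` as `(adelicFrame b)⁻¹ ∘ resAut G ∘ adelicFrame b`.
[cite: GelbartRogawski1991, §3.1 p. 454 L37–42] -/
theorem coe_frameUnitary_symm_apply (hΦ₁ : ∀ (e : E) (x y : V), Φ (e • x) y = e * Φ x y)
    (hΦ₂ : ∀ (e : E) (x y : V), Φ x (e • y) = Φ x y * σ e) (G : UnitaryGroup.adelic F E σ n (gramMatrix F E V b Φ))
    (w : AdelicSpace F V) :
    (((frameUnitary F E σ hσδ hδ hd V b Φ hΦ₁ hΦ₂).symm G : adelicUnitary F E V Φ) :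
        AdelicSpace F V ≃ₗ[AdeleRing (𝓞 F) F] AdelicSpace F V) w =
      (adelicFrame F E σ hσδ hδ hd V b).symm
        ((isQuadraticCoordinates_adele E σ hσδ hδ hd).resAut (Fin n) (G : GL (Fin n) (AdeleRing (𝓞 E) E))
          (adelicFrame F E σ hσδ hδ hd V b w)) :=
  rfl

end Unitary

/-! ## §5. Continuity -/

section Continuity

omit [NumberField E] [Algebra.IsQuadraticExtension F E] in
/-- evaluation `g ↦ g w` is continuous for the printed topology of `G(𝐀)` (pointwise convergence on `W_𝐀`, rendering R8).
[cite: GelbartRogawski1991, Prop. 3.1.1 p. 455 L1–2] -/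
theorem continuous_adelicUnitary_apply (w : AdelicSpace F V) :
    @Continuous (adelicUnitary F E V Φ) (AdelicSpace F V) _ (adelicSpaceTopology F V)
      fun g => (g : AdelicSpace F V ≃ₗ[AdeleRing (𝓞 F) F] AdelicSpace F V) w := by
  letI : TopologicalSpace (AdelicSpace F V) := adelicSpaceTopology F V
  exact continuous_iInf_dom (i := w) continuous_induced_dom

/-- **continuity of the matrix entries**: `g ↦ [g]_b ∈ M_N(𝔸_E)` is continuous on print's `G(𝐀)`.
[cite: GelbartRogawski1991, Prop. 3.1.1 p. 455 L1–2] -/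
theorem continuous_coe_frameUnitary (hΦ₁ : ∀ (e : E) (x y : V), Φ (e • x) y = e * Φ x y)
    (hΦ₂ : ∀ (e : E) (x y : V), Φ x (e • y) = Φ x y * σ e) :
    Continuous fun g : adelicUnitary F E V Φ =>
      (((frameUnitary F E σ hσδ hδ hd V b Φ hΦ₁ hΦ₂ g : UnitaryGroup.adelic F E σ n (gramMatrix F E V b Φ)) :
          GL (Fin n) (AdeleRing (𝓞 E) E)) : Matrix (Fin n) (Fin n) (AdeleRing (𝓞 E) E)) := by
  letI : TopologicalSpace (AdelicSpace F V) := adelicSpaceTopology F V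
  refine continuous_matrix fun i j => ?_
  -- the `(i, j)` entry is the `i`-th coordinate of `[g]_b · e_j = frameCoord b (g ((frameCoord b)⁻¹ e_j))`
  have hentry : ∀ g : adelicUnitary F E V Φ,
      (((frameUnitary F E σ hσδ hδ hd V b Φ hΦ₁ hΦ₂ g : UnitaryGroup.adelic F E σ n (gramMatrix F E V b Φ)) :
          GL (Fin n) (AdeleRing (𝓞 E) E)) : Matrix (Fin n) (Fin n) (AdeleRing (𝓞 E) E)) i j =
        frameCoord F E σ hσδ hδ hd V b ((g : AdelicSpace F V ≃ₗ[AdeleRing (𝓞 F) F] AdelicSpace F V)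
          ((frameCoord F E σ hσδ hδ hd V b).symm (Pi.single j 1))) i := fun g => by
    rw [frameCoord_apply_adelicUnitary, AddEquiv.apply_symm_apply, Matrix.mulVec_single_one]
    rfl
  simp_rw [hentry]
  -- `frameCoord w i = Ψ_𝔸 ((adelicFrame w).1 i, (adelicFrame w).2 i)`
  have hcoord : ∀ w : AdelicSpace F V, frameCoord F E σ hσδ hδ hd V b w i =
      quadraticAdeleEquiv F E σ hσδ hδ
        ((adelicFrame F E σ hσδ hδ hd V b w).1 i, (adelicFrame F E σ hσδ hδ hd V b w).2 i) := fun w => rfl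
  simp_rw [hcoord]
  refine (quadraticAdeleEquiv F E σ hσδ hδ).continuous.comp ?_
  have hF : Continuous fun g : adelicUnitary F E V Φ => adelicFrame F E σ hσδ hδ hd V b
      ((g : AdelicSpace F V ≃ₗ[AdeleRing (𝓞 F) F] AdelicSpace F V)
        ((frameCoord F E σ hσδ hδ hd V b).symm (Pi.single j 1))) :=
    (continuous_adelicFrame F E σ hσδ hδ hd V b).comp (continuous_adelicUnitary_apply F E V Φ _)
  exact ((continuous_apply i).comp (continuous_fst.comp hF)).prodMk
    ((continuous_apply i).comp (continuous_snd.comp hF))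

/-- `G ↦ resAut G p` is continuous on `GL_N(𝔸_E)` (entries of the restriction of scalars are polynomial in the entries of
`G`, the coordinates `re`, `im` being continuous). [cite: GelbartRogawski1991, Prop. 3.1.1 p. 455 L1–2] -/
theorem continuous_resAut_apply (p : (Fin n → AdeleRing (𝓞 F) F) × (Fin n → AdeleRing (𝓞 F) F)) :
    Continuous fun G : GL (Fin n) (AdeleRing (𝓞 E) E) => (isQuadraticCoordinates_adele E σ hσδ hδ hd).resAut (Fin n) G p := by
  have hre : Continuous (re (quadraticAdeleEquiv F E σ hσδ hδ).toAddEquiv) :=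
    continuous_re _ (quadraticAdeleEquiv F E σ hσδ hδ).symm.continuous
  have him : Continuous (im (quadraticAdeleEquiv F E σ hσδ hδ).toAddEquiv) :=
    continuous_im _ (quadraticAdeleEquiv F E σ hσδ hδ).symm.continuous
  have hM : Continuous fun G : GL (Fin n) (AdeleRing (𝓞 E) E) => ((G : Matrix (Fin n) (Fin n) (AdeleRing (𝓞 E) E))) :=
    Units.continuous_val
  have hreM : Continuous fun G : GL (Fin n) (AdeleRing (𝓞 E) E) =>
      (G : Matrix (Fin n) (Fin n) (AdeleRing (𝓞 E) E)).map (re (quadraticAdeleEquiv F E σ hσδ hδ).toAddEquiv) :=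
    continuous_matrix fun i j => hre.comp ((Continuous.matrix_elem hM i j))
  have himM : Continuous fun G : GL (Fin n) (AdeleRing (𝓞 E) E) =>
      (G : Matrix (Fin n) (Fin n) (AdeleRing (𝓞 E) E)).map (im (quadraticAdeleEquiv F E σ hσδ hδ).toAddEquiv) :=
    continuous_matrix fun i j => him.comp ((Continuous.matrix_elem hM i j))
  obtain ⟨a, c⟩ := p
  simp_rw [(isQuadraticCoordinates_adele E σ hσδ hδ hd).resAut_apply_mk]
  refine Continuous.prodMk ?_ ?_
  · exact (hreM.matrix_mulVec continuous_const).add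
      ((continuous_const_smul (algebraMap F (AdeleRing (𝓞 F) F) d)).comp (himM.matrix_mulVec continuous_const))
  · exact (himM.matrix_mulVec continuous_const).add (hreM.matrix_mulVec continuous_const)

/-- **`(frameUnitary b)⁻¹ : U(J)(𝔸_F) → G(𝐀)` is continuous** (tree topology `≤ GL_N(𝔸_E)` → printed topology of
pointwise convergence on `W_𝐀`). [cite: GelbartRogawski1991, Prop. 3.1.1 p. 455 L1–2] -/
theorem continuous_frameUnitary_symm (hΦ₁ : ∀ (e : E) (x y : V), Φ (e • x) y = e * Φ x y)
    (hΦ₂ : ∀ (e : E) (x y : V), Φ x (e • y) = Φ x y * σ e) :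
    Continuous (frameUnitary F E σ hσδ hδ hd V b Φ hΦ₁ hΦ₂).symm := by
  letI : TopologicalSpace (AdelicSpace F V) := adelicSpaceTopology F V
  refine continuous_iInf_rng.2 fun w => continuous_induced_rng.2 ?_
  show Continuous fun G : UnitaryGroup.adelic F E σ n (gramMatrix F E V b Φ) =>
    (((frameUnitary F E σ hσδ hδ hd V b Φ hΦ₁ hΦ₂).symm G : adelicUnitary F E V Φ) :
      AdelicSpace F V ≃ₗ[AdeleRing (𝓞 F) F] AdelicSpace F V) w
  simp_rw [coe_frameUnitary_symm_apply]
  exact (continuous_adelicFrame_symm F E σ hσδ hδ hd V b).comp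
    ((continuous_resAut_apply F E σ hσδ hδ hd _).comp continuous_subtype_val)

end Continuity

end Prop311

end Literature.NumberTheory.GelbartRogawski1991

end
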